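import Literature.Topology.FourManifolds.BandSumInTube
import Literature.Topology.FourManifolds.BandSumIsotopyRegular
import HarnessLib

/-!
# The band sum in an end frame has a regular presentation (collar shrink)

Topic `Literature/Topology/FourManifolds`; sequel of `BandSumInTube.lean` in the proof programme
of the named fact `Literature.Topology.FourManifolds.Knot.exists_isConnectedSum_isConcordant`
(`BandSumConcordance.lean`; Fox–Milnor (1966), §1). After `BandSumConcordanceNormal.lean` the fact
rests on Schubert's theorem in normal position (`Knot.Schubert1949_normalPosition`), whose
printed — and decomposed — form is the one for **regular** presentations
(`Knot.Schubert1949_normalPosition_regular`, `SchubertRegular.lean`: the band an injective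
immersion on a collar *larger* than the one recorded, `BandData.IsRegular`,
`BandSumIsotopyRegular.lean`). The band-sum data `KnotPiece.InTube.bandData` of the carrying
construction (`BandSumInTube.lean`) record the full collar `squareNhd C.δ` on which the band
chart `B` is controlled; beyond it the across-coordinate is clamped (`ChartData.clampS`), so these
data are not known to be regular. This file **shrinks the collar**: the same band map with a
smaller collar width `δₛ < δ` and the two arches restricted (and reparametrised) to the part
inside the smaller collar is again band-sum data for the same three knots — because near their
ends the arches run exactly along the edge lines (`SegData.cLo_of_le`, `cLo_of_mem`,
`cUp_of_mem`, `cUp_of_ge`), so that the part of the new knot in the dropped margin lies on the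
two summands — and it is regular, the band being an injective immersion on the old open collar.
Everything is proved:

* `SegData.δₛ`, `SegData.τ₀/τ₁/σ₀/σ₁` — the smaller collar width and the parameters at which the
  arches cross the new corners; `SegData.rep` — a quadratic reparametrisation of `[0, 1]` onto
  `[a, b]` fixing `1/2` (so that the orientation clause of the result, stated at the parameter
  `1/2`, transfers);
* `SegData.cLo_mem_squareNhd_iff`, `SegData.cUp_mem_squareNhd_iff` — an open arch point lies in
  the smaller collar iff its parameter lies strictly between the crossing parameters;
* `KnotPiece.InTube.bandDataₛ`, `KnotPiece.InTube.isRegular_bandDataₛ` — the shrunken band-sum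
  data and their regularity.

## References

* P. R. Cromwell, *Knots and Links* (2004), §4.6 (products along an embedded rectangle).
  [Cromwell2004]
* R. H. Fox, J. W. Milnor, Osaka J. Math. 3 (1966), §1 (the consumer). [FoxMilnor1966]

## Design notes

No statement of another file is modified; no named fact; no `sorry`; no local notation.
-/

open Set Function Metric
open scoped Topology ContDiff Manifold

noncomputable section

namespace Literature.Topology.FourManifolds

namespace BandFoliation

namespace SegData

variable {C : ChartData} (D : SegData C)

/-! ### The core continuation profile of the upper arch -/

/-- The height of the core continuation of the upper arch is affine:
`θaffInv (uD + c₁ t) = 1 + δ - v (1 - t)`. [folklore] -/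
theorem θaffInv_uD_add (t : ℝ) : C.θaffInv (D.uD + D.c₁ * t) = 1 + C.δ - D.v * (1 - t) := by
  have h := C.θaffInv_sub (D.uD + D.c₁ * t) C.θhi
  rw [C.θaffInv_θhi] at h
  have hs := C.slope_pos'
  have e : D.uD + D.c₁ * t - C.θhi = -(D.v * C.slope) * (1 - t) := by rw [uD, ← D.c₁_eq]; ring
  rw [e, show -(D.v * C.slope) * (1 - t) / C.slope = -(D.v * (1 - t)) by field_simp] at h
  linarith

/-! ### The smaller collar width -/

/-- **The smaller collar width** `δₛ`: at least `δ - v/8`, `-E (7/8)`, `Ẽ (1/8) - 1` and `δ/2`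
(so that the arches are on the edge lines wherever they are at height `≤ -δₛ` or `≥ 1 + δₛ`),
and less than `δ`. [folklore] -/
def δₛ : ℝ := max (max (C.δ - D.v / 8) (-D.E (7 / 8))) (max (D.Eup (1 / 8) - 1) (C.δ / 2))

/-- `δ - v/8 ≤ δₛ`. [folklore] -/
theorem sub_le_δₛ : C.δ - D.v / 8 ≤ D.δₛ := (le_max_left _ _).trans (le_max_left _ _)

/-- `-E (7/8) ≤ δₛ`. [folklore] -/
theorem neg_E_le_δₛ : -D.E (7 / 8) ≤ D.δₛ := (le_max_right _ _).trans (le_max_left _ _)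

/-- `Ẽ (1/8) - 1 ≤ δₛ`. [folklore] -/
theorem Eup_sub_le_δₛ : D.Eup (1 / 8) - 1 ≤ D.δₛ := (le_max_left _ _).trans (le_max_right _ _)

/-- `δ/2 ≤ δₛ`. [folklore] -/
theorem half_le_δₛ : C.δ / 2 ≤ D.δₛ := (le_max_right _ _).trans (le_max_right _ _)

/-- `0 < δₛ`. [folklore] -/
theorem δₛ_pos : 0 < D.δₛ := lt_of_lt_of_le (by linarith [C.δ_pos]) D.half_le_δₛ

/-- `δₛ < δ`. [folklore] -/
theorem δₛ_lt : D.δₛ < C.δ := by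
  have hδ := C.δ_pos
  have hv := D.v_pos
  have h1 : -D.E (7 / 8) < C.δ := by
    have := D.strictAntiOn_E ⟨by norm_num, by norm_num⟩ ⟨by norm_num, by norm_num⟩
      (show (7 / 8 : ℝ) < 1 by norm_num)
    rw [E_one] at this
    linarith
  have h2 : D.Eup (1 / 8) - 1 < C.δ := by
    have := D.strictAntiOn_Eup ⟨by norm_num, by norm_num⟩ ⟨by norm_num, by norm_num⟩
      (show (0 : ℝ) < 1 / 8 by norm_num)
    rw [Eup_zero] at this
    linarith
  refine max_lt (max_lt (by linarith) h1) (max_lt h2 (by linarith))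

/-- The smaller collar lies in the old one. [folklore] -/
theorem squareNhd_δₛ_subset : squareNhd D.δₛ ⊆ squareNhd C.δ := squareNhd_mono D.δₛ_lt.le

/-! ### The crossing parameters -/

/-- **The lower start parameter**: `fLo τ₀ = -δₛ`. [folklore] -/
def τ₀ : ℝ := (C.δ - D.δₛ) / D.v

/-- `0 < τ₀`. [folklore] -/
theorem τ₀_pos : 0 < D.τ₀ := div_pos (by linarith [D.δₛ_lt]) D.v_pos

/-- `τ₀ ≤ 1/8`. [folklore] -/
theorem τ₀_le : D.τ₀ ≤ 1 / 8 := by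
  rw [τ₀, div_le_iff₀ D.v_pos]; linarith [D.sub_le_δₛ]

/-- `fLo τ₀ = -δₛ`. [folklore] -/
theorem fLo_τ₀ : D.fLo D.τ₀ = -D.δₛ := by
  rw [fLo, τ₀, mul_div_cancel₀ _ D.v_pos.ne']; ring

/-- `fLo t ≤ -δₛ ↔ t ≤ τ₀`. [folklore] -/
theorem fLo_le_iff {t : ℝ} : D.fLo t ≤ -D.δₛ ↔ t ≤ D.τ₀ := by
  rw [← D.fLo_τ₀, fLo, fLo, add_le_add_iff_left]
  exact ⟨fun h ↦ le_of_mul_le_mul_left h D.v_pos, fun h ↦ mul_le_mul_of_nonneg_left h D.v_pos.le⟩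

/-- **The lower end parameter** `τ₁ ∈ [7/8, 1)` with `E τ₁ = -δₛ` (intermediate value theorem
for the decreasing profile `E` on `[7/8, 1]`). [folklore] -/
theorem exists_τ₁ : ∃ t ∈ Ico (7 / 8 : ℝ) 1, D.E t = -D.δₛ := by
  have hcont : ContinuousOn D.E (Icc (7 / 8 : ℝ) 1) := D.contDiff_E.continuous.continuousOn
  have hmem : -D.δₛ ∈ Icc (D.E 1) (D.E (7 / 8)) := by
    rw [E_one]; exact ⟨by linarith [D.δₛ_lt], by linarith [D.neg_E_le_δₛ]⟩
  obtain ⟨t, ht, hEt⟩ := intermediate_value_Icc' (by norm_num) hcont hmem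
  refine ⟨t, ⟨ht.1, lt_of_le_of_ne ht.2 fun h1 ↦ ?_⟩, hEt⟩
  rw [h1, E_one] at hEt
  linarith [D.δₛ_lt]

/-- The lower end parameter. [folklore] -/
def τ₁ : ℝ := Classical.choose D.exists_τ₁

/-- `τ₁ ∈ [7/8, 1)` and `E τ₁ = -δₛ`. [folklore] -/
theorem τ₁_spec : D.τ₁ ∈ Ico (7 / 8 : ℝ) 1 ∧ D.E D.τ₁ = -D.δₛ := Classical.choose_spec D.exists_τ₁

/-- For `t ∈ [0, 3/2]`: `E t ≤ -δₛ ↔ τ₁ ≤ t`. [folklore] -/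
theorem E_le_iff {t : ℝ} (ht : t ∈ Icc (0 : ℝ) (3 / 2)) : D.E t ≤ -D.δₛ ↔ D.τ₁ ≤ t := by
  obtain ⟨⟨h78, h1⟩, hE⟩ := D.τ₁_spec
  have hτ₁ : D.τ₁ ∈ Icc (0 : ℝ) (3 / 2) := ⟨by linarith, by linarith⟩
  rw [← hE]
  exact StrictAntiOn.le_iff_ge D.strictAntiOn_E ht hτ₁

/-- **The upper start parameter** `σ₀ ∈ (0, 1/8]` with `Ẽ σ₀ = 1 + δₛ` (intermediate value
theorem for the decreasing profile `Ẽ` on `[0, 1/8]`). [folklore] -/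
theorem exists_σ₀ : ∃ s ∈ Ioc (0 : ℝ) (1 / 8), D.Eup s = 1 + D.δₛ := by
  have hcont : ContinuousOn D.Eup (Icc (0 : ℝ) (1 / 8)) := D.contDiff_Eup.continuous.continuousOn
  have hmem : 1 + D.δₛ ∈ Icc (D.Eup (1 / 8)) (D.Eup 0) := by
    rw [Eup_zero]; exact ⟨by linarith [D.Eup_sub_le_δₛ], by linarith [D.δₛ_lt]⟩
  obtain ⟨s, hs, hEs⟩ := intermediate_value_Icc' (by norm_num) hcont hmem
  refine ⟨s, ⟨lt_of_le_of_ne hs.1 fun h0 ↦ ?_, hs.2⟩, hEs⟩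
  rw [← h0, Eup_zero] at hEs
  linarith [D.δₛ_lt]

/-- The upper start parameter. [folklore] -/
def σ₀ : ℝ := Classical.choose D.exists_σ₀

/-- `σ₀ ∈ (0, 1/8]` and `Ẽ σ₀ = 1 + δₛ`. [folklore] -/
theorem σ₀_spec : D.σ₀ ∈ Ioc (0 : ℝ) (1 / 8) ∧ D.Eup D.σ₀ = 1 + D.δₛ := Classical.choose_spec D.exists_σ₀

/-- For `s ∈ [-1/2, 1]`: `1 + δₛ ≤ Ẽ s ↔ s ≤ σ₀`. [folklore] -/
theorem le_Eup_iff {s : ℝ} (hs : s ∈ Icc (-(1 / 2) : ℝ) 1) : 1 + D.δₛ ≤ D.Eup s ↔ s ≤ D.σ₀ := by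
  obtain ⟨⟨h0, h18⟩, hE⟩ := D.σ₀_spec
  have hσ₀ : D.σ₀ ∈ Icc (-(1 / 2) : ℝ) 1 := ⟨by linarith, by linarith⟩
  rw [← hE]
  exact StrictAntiOn.le_iff_ge D.strictAntiOn_Eup hσ₀ hs

/-- **The upper end parameter** `σ₁ = 1 - τ₀ ∈ [7/8, 1)`, with `θaffInv (uD + c₁ σ₁) = 1 + δₛ`.
[folklore] -/
def σ₁ : ℝ := 1 - D.τ₀

/-- `7/8 ≤ σ₁`. [folklore] -/
theorem le_σ₁ : 7 / 8 ≤ D.σ₁ := by rw [σ₁]; linarith [D.τ₀_le]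

/-- `σ₁ < 1`. [folklore] -/
theorem σ₁_lt : D.σ₁ < 1 := by rw [σ₁]; linarith [D.τ₀_pos]

/-- `θaffInv (uD + c₁ σ₁) = 1 + δₛ`. [folklore] -/
theorem θaffInv_σ₁ : C.θaffInv (D.uD + D.c₁ * D.σ₁) = 1 + D.δₛ := by
  rw [D.θaffInv_uD_add, σ₁, τ₀, sub_sub_cancel, mul_div_cancel₀ _ D.v_pos.ne']; ring

/-- `1 + δₛ ≤ θaffInv (uD + c₁ s) ↔ σ₁ ≤ s`. [folklore] -/
theorem le_θaffInv_iff {s : ℝ} : 1 + D.δₛ ≤ C.θaffInv (D.uD + D.c₁ * s) ↔ D.σ₁ ≤ s := by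
  rw [← D.θaffInv_σ₁, D.θaffInv_uD_add, D.θaffInv_uD_add]
  constructor
  · intro h; nlinarith [D.v_pos]
  · intro h; nlinarith [D.v_pos]

/-! ### Where the arches lie with respect to the smaller collar -/

/-- Strictly between the crossing parameters the lower arch is above height `-δₛ`. [folklore] -/
theorem neg_δₛ_lt_cLo {s : ℝ} (hs : s ∈ Ioo D.τ₀ D.τ₁) : -D.δₛ < D.cLo s 1 := by
  obtain ⟨⟨h78, h1⟩, -⟩ := D.τ₁_spec
  rcases le_or_gt s (1 / 8) with hs1 | hs1
  · -- on the left edge line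
    rw [D.cLo_of_le hs1, pt2_apply_one]
    exact lt_of_not_ge fun h ↦ by have := D.fLo_le_iff.1 h; linarith [hs.1]
  rcases lt_or_ge s (7 / 8) with hs2 | hs2
  · -- in the middle: between the two profiles, both above `-δₛ`
    have hu := D.cLo_spec.2.2.2.2.2.1 s
    rw [D.gLo_spec.2.1 s (by linarith)] at hu
    have hf : -D.δₛ < D.fLo s :=
      lt_of_not_ge fun h ↦ by have := D.fLo_le_iff.1 h; linarith [D.τ₀_le]
    have hE : -D.δₛ < D.E s :=
      lt_of_not_ge fun h ↦ by have := (D.E_le_iff ⟨by linarith, by linarith⟩).1 h; linarith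
    rcases le_total (D.fLo s) (D.E s) with h | h
    · rw [uIcc_of_le h] at hu; exact lt_of_lt_of_le hf hu.1
    · rw [uIcc_of_ge h] at hu; exact lt_of_lt_of_le hE hu.1
  · -- on the right edge line
    rw [D.cLo_of_mem ⟨hs2, by linarith [hs.2]⟩, pt2_apply_one]
    exact lt_of_not_ge fun h ↦ by
      have := (D.E_le_iff ⟨by linarith, by linarith [hs.2]⟩).1 h; linarith [hs.2]

/-- **The lower arch and the smaller collar**: an open lower-arch point lies in the smaller
collar iff its parameter is strictly between the crossing parameters `τ₀`, `τ₁`. [folklore] -/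
theorem cLo_mem_squareNhd_iff {s : ℝ} (hs : s ∈ Ioo (0 : ℝ) 1) :
    D.cLo s ∈ squareNhd D.δₛ ↔ s ∈ Ioo D.τ₀ D.τ₁ := by
  obtain ⟨⟨h78, h1⟩, -⟩ := D.τ₁_spec
  constructor
  · intro hmem
    have hlow := (hmem 1).1
    constructor
    · by_contra hle
      push Not at hle
      rw [D.cLo_of_le (hle.trans D.τ₀_le), pt2_apply_one] at hlow
      exact (not_le.2 hlow) (D.fLo_le_iff.2 hle)
    · by_contra hle
      push Not at hle
      rw [D.cLo_of_mem ⟨h78.trans hle, by linarith [hs.2]⟩, pt2_apply_one] at hlow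
      exact (not_le.2 hlow) ((D.E_le_iff ⟨hs.1.le, by linarith [hs.2]⟩).2 hle)
  · intro hs'
    have hlt := (D.cLo_mem hs).2
    have hlow := D.neg_δₛ_lt_cLo hs'
    have h0 := D.cLo_spec.2.2.2.2.1 s
    have hδ := D.δₛ_pos
    intro i
    fin_cases i
    · change D.cLo s 0 ∈ Ioo (-D.δₛ) (1 + D.δₛ)
      exact ⟨by linarith [h0.1], by linarith [h0.2]⟩
    · change D.cLo s 1 ∈ Ioo (-D.δₛ) (1 + D.δₛ)
      norm_num at hlt
      exact ⟨hlow, by linarith⟩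

/-- Strictly between the crossing parameters the upper arch is below height `1 + δₛ`.
[folklore] -/
theorem cUp_lt_one_add_δₛ {s : ℝ} (hs : s ∈ Ioo D.σ₀ D.σ₁) : D.cUp s 1 < 1 + D.δₛ := by
  obtain ⟨⟨h0, h18⟩, -⟩ := D.σ₀_spec
  have hσ₁ := D.le_σ₁
  rcases le_or_gt s (1 / 8) with hs1 | hs1
  · -- on the right edge line
    rw [D.cUp_of_mem ⟨by linarith [hs.1], hs1⟩, pt2_apply_one]
    exact lt_of_not_ge fun h ↦ by
      have := (D.le_Eup_iff ⟨by linarith [hs.1], by linarith⟩).1 h; linarith [hs.1]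
  rcases lt_or_ge s (7 / 8) with hs2 | hs2
  · -- in the middle: the reflected arch is above `-δₛ`
    have hu := D.cUp'_spec.2.2.2.2.2.1 s
    rw [D.fUp_spec.2.1 s (by linarith)] at hu
    have hf : -D.δₛ < 1 - D.Eup s := by
      have : ¬ 1 + D.δₛ ≤ D.Eup s := fun h ↦ by
        have := (D.le_Eup_iff ⟨by linarith, by linarith⟩).1 h; linarith
      linarith [not_le.1 this]
    have hg : -D.δₛ < D.gUp s := by
      have : ¬ 1 + D.δₛ ≤ C.θaffInv (D.uD + D.c₁ * s) := fun h ↦ by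
        have := D.le_θaffInv_iff.1 h; linarith
      rw [gUp]; linarith [not_le.1 this]
    have hmin : -D.δₛ < D.cUp' s 1 := by
      rcases le_total (1 - D.Eup s) (D.gUp s) with h | h
      · rw [uIcc_of_le h] at hu; exact lt_of_lt_of_le hf hu.1
      · rw [uIcc_of_ge h] at hu; exact lt_of_lt_of_le hg hu.1
    rw [D.cUp_apply]
    linarith
  · -- on the left edge line (core continuation)
    rw [D.cUp_of_ge hs2, pt2_apply_one]
    exact lt_of_not_ge fun h ↦ by have := D.le_θaffInv_iff.1 h; linarith [hs.2]

/-- **The upper arch and the smaller collar**: an open upper-arch point lies in the smaller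
collar iff its parameter is strictly between the crossing parameters `σ₀`, `σ₁`. [folklore] -/
theorem cUp_mem_squareNhd_iff {s : ℝ} (hs : s ∈ Ioo (0 : ℝ) 1) :
    D.cUp s ∈ squareNhd D.δₛ ↔ s ∈ Ioo D.σ₀ D.σ₁ := by
  obtain ⟨⟨h0, h18⟩, -⟩ := D.σ₀_spec
  constructor
  · intro hmem
    have hup := (hmem 1).2
    constructor
    · by_contra hle
      push Not at hle
      rw [D.cUp_of_mem ⟨by linarith [hs.1], hle.trans h18⟩, pt2_apply_one] at hup
      exact (not_le.2 hup) ((D.le_Eup_iff ⟨by linarith [hs.1], hs.2.le⟩).2 hle)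
    · by_contra hle
      push Not at hle
      rw [D.cUp_of_ge (D.le_σ₁.trans hle), pt2_apply_one] at hup
      exact (not_le.2 hup) (D.le_θaffInv_iff.2 hle)
  · intro hs'
    have hgt := (D.cUp_mem hs).2
    have hup := D.cUp_lt_one_add_δₛ hs'
    have h0 := D.cUp'_spec.2.2.2.2.1 s
    have hδ := D.δₛ_pos
    intro i
    fin_cases i
    · change D.cUp s 0 ∈ Ioo (-D.δₛ) (1 + D.δₛ)
      rw [D.cUp_apply]
      exact ⟨by linarith [h0.2], by linarith [h0.1]⟩
    · change D.cUp s 1 ∈ Ioo (-D.δₛ) (1 + D.δₛ)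
      norm_num at hgt
      exact ⟨by linarith, hup⟩

/-! ### The dropped margins are covered by the ends of the arches -/

/-- Left edge, lower margin: `(0, y)` with `-δ < y ≤ -δₛ` is `cLo s` for some `s ∈ (0, τ₀]`.
[folklore] -/
theorem exists_cLo_eq_pt2_zero {y : ℝ} (hy : y ∈ Ioc (-C.δ) (-D.δₛ)) :
    ∃ s ∈ Ioc (0 : ℝ) D.τ₀, D.cLo s = pt2 0 y := by
  have hv := D.v_pos
  have hle : (y + C.δ) / D.v ≤ D.τ₀ := by
    rw [τ₀]; exact div_le_div_of_nonneg_right (by linarith [hy.2]) hv.le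
  refine ⟨(y + C.δ) / D.v, ⟨div_pos (by linarith [hy.1]) hv, hle⟩, ?_⟩
  rw [D.cLo_of_le (hle.trans D.τ₀_le), fLo, mul_div_cancel₀ _ hv.ne']
  congr 1; ring

/-- Right edge, lower margin: `(1, y)` with `-δ < y ≤ -δₛ` is `cLo s` for some `s ∈ [τ₁, 1)`
(intermediate value theorem for `E` on `[τ₁, 1]`). [folklore] -/
theorem exists_cLo_eq_pt2_one {y : ℝ} (hy : y ∈ Ioc (-C.δ) (-D.δₛ)) :
    ∃ s ∈ Ico D.τ₁ 1, D.cLo s = pt2 1 y := by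
  obtain ⟨⟨h78, h1⟩, hE⟩ := D.τ₁_spec
  have hcont : ContinuousOn D.E (Icc D.τ₁ 1) := D.contDiff_E.continuous.continuousOn
  have hmem : y ∈ Icc (D.E 1) (D.E D.τ₁) := by rw [E_one, hE]; exact ⟨hy.1.le, hy.2⟩
  obtain ⟨s, hs, hEs⟩ := intermediate_value_Icc' h1.le hcont hmem
  refine ⟨s, ⟨hs.1, lt_of_le_of_ne hs.2 fun h ↦ ?_⟩, ?_⟩
  · rw [h, E_one] at hEs; linarith [hy.1]
  · rw [D.cLo_of_mem ⟨h78.trans hs.1, by linarith [hs.2]⟩, hEs]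

/-- Right edge, upper margin: `(1, y)` with `1 + δₛ ≤ y < 1 + δ` is `cUp s` for some
`s ∈ (0, σ₀]` (intermediate value theorem for `Ẽ` on `[0, σ₀]`). [folklore] -/
theorem exists_cUp_eq_pt2_one {y : ℝ} (hy : y ∈ Ico (1 + D.δₛ) (1 + C.δ)) :
    ∃ s ∈ Ioc (0 : ℝ) D.σ₀, D.cUp s = pt2 1 y := by
  obtain ⟨⟨h0, h18⟩, hE⟩ := D.σ₀_spec
  have hcont : ContinuousOn D.Eup (Icc 0 D.σ₀) := D.contDiff_Eup.continuous.continuousOn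
  have hmem : y ∈ Icc (D.Eup D.σ₀) (D.Eup 0) := by rw [Eup_zero, hE]; exact ⟨hy.1, hy.2.le⟩
  obtain ⟨s, hs, hEs⟩ := intermediate_value_Icc' h0.le hcont hmem
  refine ⟨s, ⟨lt_of_le_of_ne hs.1 fun h ↦ ?_, hs.2⟩, ?_⟩
  · rw [← h, Eup_zero] at hEs; linarith [hy.2]
  · rw [D.cUp_of_mem ⟨by linarith [hs.1], hs.2.trans h18⟩, hEs]

/-- Left edge, upper margin: `(0, y)` with `1 + δₛ ≤ y < 1 + δ` is `cUp s` for some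
`s ∈ [σ₁, 1)` (the core continuation is affine). [folklore] -/
theorem exists_cUp_eq_pt2_zero {y : ℝ} (hy : y ∈ Ico (1 + D.δₛ) (1 + C.δ)) :
    ∃ s ∈ Ico D.σ₁ 1, D.cUp s = pt2 0 y := by
  have hv := D.v_pos
  have hq : 0 < (1 + C.δ - y) / D.v := div_pos (by linarith [hy.2]) hv
  have hq' : (1 + C.δ - y) / D.v ≤ (C.δ - D.δₛ) / D.v :=
    div_le_div_of_nonneg_right (by linarith [hy.1]) hv.le
  have hge : D.σ₁ ≤ 1 - (1 + C.δ - y) / D.v := by rw [σ₁, τ₀]; linarith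
  refine ⟨1 - (1 + C.δ - y) / D.v, ⟨hge, by linarith⟩, ?_⟩
  rw [D.cUp_of_ge (D.le_σ₁.trans hge), D.θaffInv_uD_add, sub_sub_cancel, mul_div_cancel₀ _ hv.ne']
  congr 1; ring

/-! ### A reparametrisation of `[0, 1]` fixing `1/2` -/

/-- The quadratic coefficient `κ = 4 m - 2` of the reparametrisation, `m = (1/2 - a)/(b - a)` the
relative position of `1/2` in `[a, b]`. [folklore] -/
def repκ (a b : ℝ) : ℝ := 4 * ((2⁻¹ - a) / (b - a)) - 2

/-- **The reparametrisation** `rep a b t = a + (b - a) (t + κ t (1 - t))`: a polynomial with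
`rep 0 = a`, `rep 1 = b`, `rep (1/2) = 1/2`, strictly increasing on `[0, 1]` when `a ≤ 1/8` and
`7/8 ≤ b ≤ 1` (then `|κ| ≤ 2/3`). [folklore] -/
def rep (a b t : ℝ) : ℝ := a + (b - a) * (t + repκ a b * (t * (1 - t)))

/-- `rep a b 0 = a`. [folklore] -/
theorem rep_zero (a b : ℝ) : rep a b 0 = a := by simp [rep]

/-- `rep a b 1 = b`. [folklore] -/
theorem rep_one (a b : ℝ) : rep a b 1 = b := by simp [rep]

/-- `rep a b (1/2) = 1/2`. [folklore] -/
theorem rep_half {a b : ℝ} (hab : a < b) : rep a b 2⁻¹ = 2⁻¹ := by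
  have hba : b - a ≠ 0 := by linarith
  rw [rep, repκ]
  field_simp
  ring

/-- `|κ| ≤ 2/3` for `0 ≤ a ≤ 1/8`, `7/8 ≤ b ≤ 1`. [folklore] -/
theorem abs_repκ_le {a b : ℝ} (ha : a ∈ Icc (0 : ℝ) (1 / 8)) (hb : b ∈ Icc (7 / 8 : ℝ) 1) :
    |repκ a b| ≤ 2 / 3 := by
  have hba : 0 < b - a := by linarith [ha.2, hb.1]
  have hm1 : 3 / 8 ≤ (2⁻¹ - a) / (b - a) := by
    rw [le_div_iff₀ hba]; nlinarith [ha.1, ha.2, hb.1, hb.2]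
  have hm2 : (2⁻¹ - a) / (b - a) ≤ 2 / 3 := by
    rw [div_le_iff₀ hba]; nlinarith [ha.1, ha.2, hb.1, hb.2]
  rw [repκ, abs_le]
  constructor <;> linarith

/-- The derivative of the reparametrisation. [folklore] -/
theorem hasDerivAt_rep (a b t : ℝ) :
    HasDerivAt (rep a b) ((b - a) * (1 + repκ a b * (1 - 2 * t))) t := by
  have h1 : HasDerivAt (fun t : ℝ ↦ t * (1 - t)) (1 * (1 - t) + t * (0 - 1)) t :=
    (hasDerivAt_id' t).mul ((hasDerivAt_const t (1 : ℝ)).sub (hasDerivAt_id' t))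
  have h2 := (((hasDerivAt_id' t).add (h1.const_mul (repκ a b))).const_mul (b - a)).const_add a
  unfold rep
  refine h2.congr_deriv ?_
  ring

/-- The reparametrisation is `C^∞`. [folklore] -/
theorem contDiff_rep (a b : ℝ) : ContDiff ℝ ∞ (rep a b) := by
  unfold rep
  fun_prop

/-- The derivative of the reparametrisation is positive on `[0, 1]`. [folklore] -/
theorem deriv_rep_pos {a b : ℝ} (ha : a ∈ Icc (0 : ℝ) (1 / 8)) (hb : b ∈ Icc (7 / 8 : ℝ) 1) {t : ℝ}
    (ht : t ∈ Icc (0 : ℝ) 1) : 0 < deriv (rep a b) t := by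
  rw [(hasDerivAt_rep a b t).deriv]
  have hba : 0 < b - a := by linarith [ha.2, hb.1]
  have hκ := abs_le.1 (abs_repκ_le ha hb)
  refine mul_pos hba ?_
  have h12 : |1 - 2 * t| ≤ 1 := abs_le.2 ⟨by linarith [ht.2], by linarith [ht.1]⟩
  have : |repκ a b * (1 - 2 * t)| ≤ 2 / 3 := by
    rw [abs_mul]
    calc |repκ a b| * |1 - 2 * t| ≤ 2 / 3 * 1 :=
          mul_le_mul (abs_repκ_le ha hb) h12 (abs_nonneg _) (by norm_num)
      _ = 2 / 3 := by norm_num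
  have := neg_abs_le (repκ a b * (1 - 2 * t))
  linarith

/-- The reparametrisation is strictly increasing on `[0, 1]`. [folklore] -/
theorem strictMonoOn_rep {a b : ℝ} (ha : a ∈ Icc (0 : ℝ) (1 / 8)) (hb : b ∈ Icc (7 / 8 : ℝ) 1) :
    StrictMonoOn (rep a b) (Icc (0 : ℝ) 1) :=
  strictMonoOn_of_deriv_pos (convex_Icc _ _) (contDiff_rep a b).continuous.continuousOn
    fun t ht ↦ deriv_rep_pos ha hb (by rw [interior_Icc] at ht; exact Ioo_subset_Icc_self ht)

/-- The reparametrisation maps `(0, 1)` into `(a, b)`. [folklore] -/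
theorem rep_mem_Ioo {a b : ℝ} (ha : a ∈ Icc (0 : ℝ) (1 / 8)) (hb : b ∈ Icc (7 / 8 : ℝ) 1) {t : ℝ}
    (ht : t ∈ Ioo (0 : ℝ) 1) : rep a b t ∈ Ioo a b := by
  have hm := strictMonoOn_rep ha hb
  constructor
  · have := hm ⟨le_rfl, by norm_num⟩ ⟨ht.1.le, ht.2.le⟩ ht.1
    rwa [rep_zero] at this
  · have := hm ⟨ht.1.le, ht.2.le⟩ ⟨by norm_num, le_rfl⟩ ht.2
    rwa [rep_one] at this

/-- The reparametrisation maps `(0, 1)` onto `(a, b)`. [folklore] -/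
theorem image_rep_Ioo {a b : ℝ} (ha : a ∈ Icc (0 : ℝ) (1 / 8)) (hb : b ∈ Icc (7 / 8 : ℝ) 1) :
    rep a b '' Ioo 0 1 = Ioo a b := by
  refine Subset.antisymm ?_ ?_
  · rintro _ ⟨t, ht, rfl⟩; exact rep_mem_Ioo ha hb ht
  · have h := intermediate_value_Ioo (show (0 : ℝ) ≤ 1 by norm_num)
      (contDiff_rep a b).continuous.continuousOn
    rwa [rep_zero, rep_one] at h

/-! ### The restricted arches -/

/-- **The restricted lower arch**: the part of the lower arch inside the smaller collar,
reparametrised by `[0, 1]` with the parameter `1/2` fixed. [folklore] -/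
def cLoₛ (t : ℝ) : EuclideanSpace ℝ (Fin 2) := D.cLo (rep D.τ₀ D.τ₁ t)

/-- **The restricted upper arch.** [folklore] -/
def cUpₛ (t : ℝ) : EuclideanSpace ℝ (Fin 2) := D.cUp (rep D.σ₀ D.σ₁ t)

/-- The crossing parameters of the lower arch are admissible for `rep`. [folklore] -/
theorem τ_mem : D.τ₀ ∈ Icc (0 : ℝ) (1 / 8) ∧ D.τ₁ ∈ Icc (7 / 8 : ℝ) 1 :=
  ⟨⟨D.τ₀_pos.le, D.τ₀_le⟩, ⟨D.τ₁_spec.1.1, D.τ₁_spec.1.2.le⟩⟩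

/-- The crossing parameters of the upper arch are admissible for `rep`. [folklore] -/
theorem σ_mem : D.σ₀ ∈ Icc (0 : ℝ) (1 / 8) ∧ D.σ₁ ∈ Icc (7 / 8 : ℝ) 1 :=
  ⟨⟨D.σ₀_spec.1.1.le, D.σ₀_spec.1.2⟩, ⟨D.le_σ₁, D.σ₁_lt.le⟩⟩

/-- The restricted lower arch is `C^∞`. [folklore] -/
theorem contDiff_cLoₛ : ContDiff ℝ ∞ D.cLoₛ := D.cLo_spec.1.comp (contDiff_rep _ _)

/-- The restricted upper arch is `C^∞`. [folklore] -/
theorem contDiff_cUpₛ : ContDiff ℝ ∞ D.cUpₛ := D.contDiff_cUp.comp (contDiff_rep _ _)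

/-- The restricted lower arch is injective on `(0, 1)`. [folklore] -/
theorem injOn_cLoₛ : InjOn D.cLoₛ (Ioo 0 1) := fun _ hs _ ht hst ↦
  (strictMonoOn_rep D.τ_mem.1 D.τ_mem.2).injOn (Ioo_subset_Icc_self hs) (Ioo_subset_Icc_self ht)
    (D.cLo_spec.2.2.2.2.2.2.1 hst)

/-- The restricted upper arch is injective on `(0, 1)`. [folklore] -/
theorem injOn_cUpₛ : InjOn D.cUpₛ (Ioo 0 1) := fun _ hs _ ht hst ↦
  (strictMonoOn_rep D.σ_mem.1 D.σ_mem.2).injOn (Ioo_subset_Icc_self hs) (Ioo_subset_Icc_self ht)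
    (D.injective_cUp hst)

/-- The derivative of the restricted lower arch (chain rule). [folklore] -/
theorem hasDerivAt_cLoₛ (t : ℝ) :
    HasDerivAt D.cLoₛ (deriv (rep D.τ₀ D.τ₁) t • deriv D.cLo (rep D.τ₀ D.τ₁ t)) t := by
  have hc : HasDerivAt D.cLo (deriv D.cLo (rep D.τ₀ D.τ₁ t)) (rep D.τ₀ D.τ₁ t) :=
    ((D.cLo_spec.1.differentiable (by simp)) _).hasDerivAt
  exact hc.scomp t (hasDerivAt_rep _ _ t).differentiableAt.hasDerivAt

/-- The derivative of the restricted upper arch (chain rule). [folklore] -/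
theorem hasDerivAt_cUpₛ (t : ℝ) :
    HasDerivAt D.cUpₛ (deriv (rep D.σ₀ D.σ₁) t • deriv D.cUp (rep D.σ₀ D.σ₁ t)) t := by
  have hc : HasDerivAt D.cUp (deriv D.cUp (rep D.σ₀ D.σ₁ t)) (rep D.σ₀ D.σ₁ t) :=
    ((D.contDiff_cUp.differentiable (by simp)) _).hasDerivAt
  exact hc.scomp t (hasDerivAt_rep _ _ t).differentiableAt.hasDerivAt

/-- The restricted lower arch is regular on `(0, 1)`. [folklore] -/
theorem deriv_cLoₛ_ne_zero {t : ℝ} (ht : t ∈ Ioo (0 : ℝ) 1) : deriv D.cLoₛ t ≠ 0 := by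
  rw [(D.hasDerivAt_cLoₛ t).deriv]
  exact smul_ne_zero (deriv_rep_pos D.τ_mem.1 D.τ_mem.2 (Ioo_subset_Icc_self ht)).ne'
    (D.cLo_spec.2.2.2.2.2.2.2 _)

/-- The restricted upper arch is regular on `(0, 1)`. [folklore] -/
theorem deriv_cUpₛ_ne_zero {t : ℝ} (ht : t ∈ Ioo (0 : ℝ) 1) : deriv D.cUpₛ t ≠ 0 := by
  rw [(D.hasDerivAt_cUpₛ t).deriv]
  exact smul_ne_zero (deriv_rep_pos D.σ_mem.1 D.σ_mem.2 (Ioo_subset_Icc_self ht)).ne'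
    (D.deriv_cUp_ne_zero _)

/-- The restricted lower arch starts at the new lower-left corner. [folklore] -/
theorem cLoₛ_zero : D.cLoₛ 0 = pt2 0 (-D.δₛ) := by
  rw [cLoₛ, rep_zero, D.cLo_of_le D.τ₀_le, D.fLo_τ₀]

/-- The restricted lower arch ends at the new lower-right corner. [folklore] -/
theorem cLoₛ_one : D.cLoₛ 1 = pt2 1 (-D.δₛ) := by
  rw [cLoₛ, rep_one, D.cLo_of_mem ⟨D.τ₁_spec.1.1, by linarith [D.τ₁_spec.1.2]⟩, D.τ₁_spec.2]

/-- The restricted upper arch starts at the new upper-right corner. [folklore] -/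
theorem cUpₛ_zero : D.cUpₛ 0 = pt2 1 (1 + D.δₛ) := by
  rw [cUpₛ, rep_zero, D.cUp_of_mem ⟨by linarith [D.σ₀_spec.1.1], D.σ₀_spec.1.2⟩, D.σ₀_spec.2]

/-- The restricted upper arch ends at the new upper-left corner. [folklore] -/
theorem cUpₛ_one : D.cUpₛ 1 = pt2 0 (1 + D.δₛ) := by
  rw [cUpₛ, rep_one, D.cUp_of_ge D.le_σ₁, D.θaffInv_σ₁]

/-- The restricted lower arch at `1/2` is the lower arch at `1/2`. [folklore] -/
theorem cLoₛ_half : D.cLoₛ 2⁻¹ = D.cLo 2⁻¹ := by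
  rw [cLoₛ, rep_half (by linarith [D.τ₀_le, D.τ₁_spec.1.1])]

/-- The open restricted lower arch lies in the lower half of the smaller collar. [folklore] -/
theorem cLoₛ_mem {t : ℝ} (ht : t ∈ Ioo (0 : ℝ) 1) : D.cLoₛ t ∈ squareNhd D.δₛ ∧ D.cLoₛ t 1 < 2⁻¹ := by
  have hr := rep_mem_Ioo D.τ_mem.1 D.τ_mem.2 ht
  have hr' : rep D.τ₀ D.τ₁ t ∈ Ioo (0 : ℝ) 1 :=
    ⟨D.τ₀_pos.trans hr.1, hr.2.trans D.τ₁_spec.1.2⟩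
  exact ⟨(D.cLo_mem_squareNhd_iff hr').2 hr, (D.cLo_mem hr').2⟩

/-- The open restricted upper arch lies in the upper half of the smaller collar. [folklore] -/
theorem cUpₛ_mem {t : ℝ} (ht : t ∈ Ioo (0 : ℝ) 1) : D.cUpₛ t ∈ squareNhd D.δₛ ∧ 2⁻¹ < D.cUpₛ t 1 := by
  have hr := rep_mem_Ioo D.σ_mem.1 D.σ_mem.2 ht
  have hr' : rep D.σ₀ D.σ₁ t ∈ Ioo (0 : ℝ) 1 :=
    ⟨D.σ₀_spec.1.1.trans hr.1, hr.2.trans D.σ₁_lt⟩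
  exact ⟨(D.cUp_mem_squareNhd_iff hr').2 hr, (D.cUp_mem hr').2⟩

/-- The image of the open restricted lower arch. [folklore] -/
theorem image_cLoₛ : D.cLoₛ '' Ioo 0 1 = D.cLo '' Ioo D.τ₀ D.τ₁ := by
  rw [show D.cLoₛ = D.cLo ∘ rep D.τ₀ D.τ₁ from rfl, image_comp, image_rep_Ioo D.τ_mem.1 D.τ_mem.2]

/-- The image of the open restricted upper arch. [folklore] -/
theorem image_cUpₛ : D.cUpₛ '' Ioo 0 1 = D.cUp '' Ioo D.σ₀ D.σ₁ := by
  rw [show D.cUpₛ = D.cUp ∘ rep D.σ₀ D.σ₁ from rfl, image_comp, image_rep_Ioo D.σ_mem.1 D.σ_mem.2]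

/-- **The arches inside the smaller collar are the restricted arches**: intersecting the union
of the two open arches with the smaller collar leaves exactly the images of the two open
restricted arches. [folklore] -/
theorem arcs_inter_squareNhd :
    (D.cLo '' Ioo 0 1 ∪ D.cUp '' Ioo 0 1) ∩ squareNhd D.δₛ = D.cLoₛ '' Ioo 0 1 ∪ D.cUpₛ '' Ioo 0 1 := by
  rw [D.image_cLoₛ, D.image_cUpₛ]
  ext x
  simp only [mem_inter_iff, mem_union, mem_image]
  constructor
  · rintro ⟨⟨s, hs, rfl⟩ | ⟨s, hs, rfl⟩, hx⟩
    · exact Or.inl ⟨s, (D.cLo_mem_squareNhd_iff hs).1 hx, rfl⟩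
    · exact Or.inr ⟨s, (D.cUp_mem_squareNhd_iff hs).1 hx, rfl⟩
  · rintro (⟨s, hs, rfl⟩ | ⟨s, hs, rfl⟩)
    · have hs' : s ∈ Ioo (0 : ℝ) 1 := ⟨D.τ₀_pos.trans hs.1, hs.2.trans D.τ₁_spec.1.2⟩
      exact ⟨Or.inl ⟨s, hs', rfl⟩, (D.cLo_mem_squareNhd_iff hs').2 hs⟩
    · have hs' : s ∈ Ioo (0 : ℝ) 1 := ⟨D.σ₀_spec.1.1.trans hs.1, hs.2.trans D.σ₁_lt⟩
      exact ⟨Or.inr ⟨s, hs', rfl⟩, (D.cUp_mem_squareNhd_iff hs').2 hs⟩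

end SegData

/-- The point of the plane with given coordinates is the point. [folklore] -/
theorem pt2_eta (x : EuclideanSpace ℝ (Fin 2)) : pt2 (x 0) (x 1) = x := by
  ext i; fin_cases i <;> rfl

namespace KnotPiece

variable {C : ChartData} {D : SegData C} {P : KnotPiece C D}

namespace InTube

variable {η ε : ℝ} {E : EndFrame η ε} {Kend tiny Knew : Knot} (h : P.InTube E Kend tiny Knew)
include h

/-! ### The band-sum clauses for the smaller collar -/

/-- The end knot meets the smaller collar exactly in the left edge line. [folklore] -/
theorem preimage_left_δₛ :
    h.band ⁻¹' range Kend ∩ squareNhd D.δₛ = {x ∈ squareNhd D.δₛ | x 0 = 0} := by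
  ext x
  have hx := Set.ext_iff.mp h.preimage_left x
  simp only [mem_inter_iff, mem_preimage, mem_setOf_eq] at hx ⊢
  constructor
  · rintro ⟨hK, hsq⟩; exact ⟨hsq, (hx.1 ⟨hK, D.squareNhd_δₛ_subset hsq⟩).2⟩
  · rintro ⟨hsq, h0⟩; exact ⟨(hx.2 ⟨D.squareNhd_δₛ_subset hsq, h0⟩).1, hsq⟩

/-- The small knot meets the smaller collar exactly in the right edge line. [folklore] -/
theorem preimage_right_δₛ :
    h.band ⁻¹' range tiny ∩ squareNhd D.δₛ = {x ∈ squareNhd D.δₛ | x 0 = 1} := by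
  ext x
  have hx := Set.ext_iff.mp h.preimage_right x
  simp only [mem_inter_iff, mem_preimage, mem_setOf_eq] at hx ⊢
  constructor
  · rintro ⟨hK, hsq⟩; exact ⟨hsq, (hx.1 ⟨hK, D.squareNhd_δₛ_subset hsq⟩).2⟩
  · rintro ⟨hsq, h0⟩; exact ⟨(hx.2 ⟨D.squareNhd_δₛ_subset hsq, h0⟩).1, hsq⟩

/-- Inside the smaller collar the new knot is exactly the two open restricted arches.
[folklore] -/
theorem preimage_range_δₛ :
    h.band ⁻¹' range Knew ∩ squareNhd D.δₛ = D.cLoₛ '' Ioo 0 1 ∪ D.cUpₛ '' Ioo 0 1 := by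
  rw [← D.arcs_inter_squareNhd, ← h.preimage_range, inter_assoc,
    inter_eq_right.2 D.squareNhd_δₛ_subset]

/-- **In the dropped margin the new knot lies on the summands**: a band point over the old collar
but outside the smaller one which lies on `Knew` is an arch point with parameter outside the
crossing parameters, hence on an edge line, hence on `Kend` or on `tiny`. [folklore] -/
theorem band_mem_union_of_notMem {x : EuclideanSpace ℝ (Fin 2)} (hx : x ∈ squareNhd C.δ)
    (hx' : x ∉ squareNhd D.δₛ) (hK : h.band x ∈ range Knew) :
    h.band x ∈ range Kend ∪ range tiny := by
  have harc : x ∈ D.cLo '' Ioo 0 1 ∪ D.cUp '' Ioo 0 1 := by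
    rw [← h.preimage_range]; exact ⟨hK, hx⟩
  rcases harc with ⟨s, hs, rfl⟩ | ⟨s, hs, rfl⟩
  · have hs' : ¬ s ∈ Ioo D.τ₀ D.τ₁ := fun h' ↦ hx' ((D.cLo_mem_squareNhd_iff hs).2 h')
    rcases le_or_gt s D.τ₀ with hle | hgt
    · left
      have hmem : D.cLo s ∈ h.band ⁻¹' range Kend ∩ squareNhd C.δ := by
        rw [h.preimage_left]
        exact ⟨hx, by rw [D.cLo_of_le (hle.trans D.τ₀_le), pt2_apply_zero]⟩
      exact hmem.1
    · have hge : D.τ₁ ≤ s := by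
        by_contra hlt
        push Not at hlt
        exact hs' ⟨hgt, hlt⟩
      right
      have hmem : D.cLo s ∈ h.band ⁻¹' range tiny ∩ squareNhd C.δ := by
        rw [h.preimage_right]
        exact ⟨hx, by rw [D.cLo_of_mem ⟨D.τ₁_spec.1.1.trans hge, by linarith [hs.2]⟩, pt2_apply_zero]⟩
      exact hmem.1
  · have hs' : ¬ s ∈ Ioo D.σ₀ D.σ₁ := fun h' ↦ hx' ((D.cUp_mem_squareNhd_iff hs).2 h')
    rcases le_or_gt s D.σ₀ with hle | hgt
    · right
      have hmem : D.cUp s ∈ h.band ⁻¹' range tiny ∩ squareNhd C.δ := by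
        rw [h.preimage_right]
        exact ⟨hx, by rw [D.cUp_of_mem ⟨by linarith [hs.1], hle.trans D.σ₀_spec.1.2⟩, pt2_apply_zero]⟩
      exact hmem.1
    · have hge : D.σ₁ ≤ s := by
        by_contra hlt
        push Not at hlt
        exact hs' ⟨hgt, hlt⟩
      left
      have hmem : D.cUp s ∈ h.band ⁻¹' range Kend ∩ squareNhd C.δ := by
        rw [h.preimage_left]
        exact ⟨hx, by rw [D.cUp_of_ge (D.le_σ₁.trans hge), pt2_apply_zero]⟩
      exact hmem.1

/-- **The dropped margins of the summands lie on the new knot**: a band point over the old collar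
but outside the smaller one which lies on `Kend` or on `tiny` is an edge-line point in a margin,
hence an end point of an arch, hence on `Knew`. [folklore] -/
theorem band_mem_range_of_notMem {x : EuclideanSpace ℝ (Fin 2)} (hx : x ∈ squareNhd C.δ)
    (hx' : x ∉ squareNhd D.δₛ) (hK : h.band x ∈ range Kend ∪ range tiny) :
    h.band x ∈ range Knew := by
  have hδ := D.δₛ_pos
  have key : ∀ {s : ℝ}, s ∈ Ioo (0 : ℝ) 1 → (D.cLo s = x ∨ D.cUp s = x) → h.band x ∈ range Knew := by
    intro s hs hxs
    have hmem : x ∈ h.band ⁻¹' range Knew ∩ squareNhd C.δ := by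
      rw [h.preimage_range]
      rcases hxs with hxs | hxs
      · exact Or.inl ⟨s, hs, hxs⟩
      · exact Or.inr ⟨s, hs, hxs⟩
    exact hmem.1
  have hx1 : x 1 ∈ Ioo (-C.δ) (1 + C.δ) := hx 1
  -- the across-coordinate is `0` or `1`, so the along-coordinate is in a margin
  have margin : x 0 = 0 ∨ x 0 = 1 → x 1 ≤ -D.δₛ ∨ 1 + D.δₛ ≤ x 1 := by
    intro h0
    by_contra hc
    push Not at hc
    apply hx'
    intro i
    fin_cases i
    · change x 0 ∈ Ioo (-D.δₛ) (1 + D.δₛ)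
      rcases h0 with h0 | h0 <;> rw [h0] <;> constructor <;> linarith
    · exact ⟨hc.1, hc.2⟩
  rcases hK with hK | hK
  · have h0 : x 0 = 0 := by
      have : x ∈ h.band ⁻¹' range Kend ∩ squareNhd C.δ := ⟨hK, hx⟩
      rw [h.preimage_left] at this
      exact this.2
    rcases margin (Or.inl h0) with hle | hge
    · obtain ⟨s, hs, hxs⟩ := D.exists_cLo_eq_pt2_zero ⟨hx1.1, hle⟩
      refine key ⟨hs.1, lt_of_le_of_lt hs.2 (by linarith [D.τ₀_le])⟩ (Or.inl ?_)
      rw [hxs, ← h0, pt2_eta]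
    · obtain ⟨s, hs, hxs⟩ := D.exists_cUp_eq_pt2_zero ⟨hge, hx1.2⟩
      refine key ⟨lt_of_lt_of_le (by linarith [D.le_σ₁]) hs.1, hs.2⟩ (Or.inr ?_)
      rw [hxs, ← h0, pt2_eta]
  · have h0 : x 0 = 1 := by
      have : x ∈ h.band ⁻¹' range tiny ∩ squareNhd C.δ := ⟨hK, hx⟩
      rw [h.preimage_right] at this
      exact this.2
    rcases margin (Or.inr h0) with hle | hge
    · obtain ⟨s, hs, hxs⟩ := D.exists_cLo_eq_pt2_one ⟨hx1.1, hle⟩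
      refine key ⟨lt_of_lt_of_le (by linarith [D.τ₁_spec.1.1]) hs.1, hs.2⟩ (Or.inl ?_)
      rw [hxs, ← h0, pt2_eta]
    · obtain ⟨s, hs, hxs⟩ := D.exists_cUp_eq_pt2_one ⟨hge, hx1.2⟩
      refine key ⟨hs.1, lt_of_le_of_lt hs.2 (by linarith [D.σ₀_spec.1.2])⟩ (Or.inr ?_)
      rw [hxs, ← h0, pt2_eta]

/-- Outside the smaller band image, the new knot is `Kend ∪ tiny`. [folklore] -/
theorem range_diff_δₛ :
    range Knew \ h.band '' squareNhd D.δₛ = (range Kend ∪ range tiny) \ h.band '' squareNhd D.δₛ := by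
  ext y
  constructor
  · rintro ⟨hyK, hyU'⟩
    refine ⟨?_, hyU'⟩
    by_cases hyU : y ∈ h.band '' squareNhd C.δ
    · obtain ⟨x, hx, rfl⟩ := hyU
      exact h.band_mem_union_of_notMem hx (fun hx' ↦ hyU' ⟨x, hx', rfl⟩) hyK
    · have : y ∈ range Knew \ h.imB := ⟨hyK, hyU⟩
      rw [h.range_diff] at this
      exact this.1
  · rintro ⟨hyK, hyU'⟩
    refine ⟨?_, hyU'⟩
    by_cases hyU : y ∈ h.band '' squareNhd C.δ
    · obtain ⟨x, hx, rfl⟩ := hyU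
      exact h.band_mem_range_of_notMem hx (fun hx' ↦ hyU' ⟨x, hx', rfl⟩) hyK
    · have : y ∈ (range Kend ∪ range tiny) \ h.imB := ⟨hyK, hyU⟩
      rw [← h.range_diff] at this
      exact this.1

/-- **Orientation of the new knot along the restricted lower arch**: the clause at the parameter
`1/2` transfers because the reparametrisation fixes `1/2` and has positive derivative there.
[folklore] -/
theorem orient_result_δₛ : ∃ θ c : ℝ, 0 < c ∧ Knew (circlePoint θ) = h.band (D.cLoₛ 2⁻¹) ∧
    deriv (fun t ↦ ((Knew (circlePoint t) : sphere (0 : EuclideanSpace ℝ (Fin 4)) 1) :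
      EuclideanSpace ℝ (Fin 4))) θ =
      c • fderiv ℝ (fun x ↦ ((h.band x : sphere (0 : EuclideanSpace ℝ (Fin 4)) 1) :
        EuclideanSpace ℝ (Fin 4))) (D.cLoₛ 2⁻¹) (deriv D.cLoₛ 2⁻¹) := by
  obtain ⟨θ, c, hc, hpt, hder⟩ := h.orient_result
  set r := deriv (SegData.rep D.τ₀ D.τ₁) 2⁻¹ with hr
  have hr0 : 0 < r := SegData.deriv_rep_pos D.τ_mem.1 D.τ_mem.2 ⟨by norm_num, by norm_num⟩
  have hd : deriv D.cLoₛ 2⁻¹ = r • deriv D.cLo 2⁻¹ := by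
    rw [(D.hasDerivAt_cLoₛ 2⁻¹).deriv, SegData.rep_half (by linarith [D.τ₀_le, D.τ₁_spec.1.1])]
  refine ⟨θ, c / r, div_pos hc hr0, by rw [D.cLoₛ_half]; exact hpt, ?_⟩
  rw [D.cLoₛ_half, hd, ContinuousLinearMap.map_smul, smul_smul, div_mul_cancel₀ _ hr0.ne', hder]

/-! ### The shrunken band-sum data -/

/-- **The band sum in an end frame with the smaller collar**: the same band map `c ∘ B` and the
restricted arches. [folklore] -/
def bandDataₛ : BandData Kend tiny Knew ∅ where
  band := h.band
  δ := D.δₛ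
  δ_pos := D.δₛ_pos
  contMDiff := h.contMDiff_band
  injOn := h.injOn_band.mono D.squareNhd_δₛ_subset
  injective_mfderiv := fun _ hx ↦ h.injective_mfderiv_band (D.squareNhd_δₛ_subset hx)
  disjoint_avoid := disjoint_empty _
  preimage_left := h.preimage_left_δₛ
  preimage_right := h.preimage_right_δₛ
  range_diff := h.range_diff_δₛ
  lowerArc := D.cLoₛ
  upperArc := D.cUpₛ
  contDiff_lowerArc := D.contDiff_cLoₛ
  contDiff_upperArc := D.contDiff_cUpₛ
  injOn_lowerArc := D.injOn_cLoₛ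
  injOn_upperArc := D.injOn_cUpₛ
  deriv_lowerArc_ne_zero := fun _ ht ↦ D.deriv_cLoₛ_ne_zero ht
  deriv_upperArc_ne_zero := fun _ ht ↦ D.deriv_cUpₛ_ne_zero ht
  lowerArc_zero := D.cLoₛ_zero
  lowerArc_one := D.cLoₛ_one
  upperArc_zero := D.cUpₛ_zero
  upperArc_one := D.cUpₛ_one
  lowerArc_mem := fun _ ht ↦ D.cLoₛ_mem ht
  upperArc_mem := fun _ ht ↦ D.cUpₛ_mem ht
  preimage_range := h.preimage_range_δₛ
  orient_left := h.orient_left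
  orient_right := h.orient_right
  orient_result := h.orient_result_δₛ

/-- The band of the shrunken data is `cS ∘ B`. [folklore] -/
@[simp] theorem bandDataₛ_band : h.bandDataₛ.band = E.cS ∘ C.B := rfl

/-- The collar width of the shrunken data is `δₛ`. [folklore] -/
@[simp] theorem bandDataₛ_δ : h.bandDataₛ.δ = D.δₛ := rfl

/-- The shrunken collar is smaller than the chart collar. [folklore] -/
theorem bandDataₛ_δ_lt : h.bandDataₛ.δ < C.δ := D.δₛ_lt

/-- **The shrunken band-sum data are regular**: the band is an injective immersion on the old
open collar `squareNhd C.δ`, which is larger. Cromwell (2004), §4.6 (the embedded rectangle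
`R`). [cite: Cromwell2004, §4.6] -/
theorem isRegular_bandDataₛ : h.bandDataₛ.IsRegular :=
  ⟨C.δ, D.δₛ_lt, h.injOn_band, fun _ hx ↦ h.injective_mfderiv_band hx⟩

end InTube

end KnotPiece

end BandFoliation

end Literature.Topology.FourManifolds
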